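import Summits.FinalStateConjecture.FinalStateConjecture.Theorems.SwallowTheDatumSubdataDevelopmentsEmbedRestart
import Literature.Geometry.Lorentzian.CommonDevelopmentBoundaryData
import HarnessLib

/-!
# Route SwallowTheDatum · item `SubdataDevelopmentsEmbed` (stmt-FinalStateConjecture-10053) —
# the boundary data `hbd` DISCHARGED: the item and Sbierski's Theorem 12 from local uniqueness
# alone

`…Restart.lean` reduced the item to local geometric uniqueness (LU,
`hawkingEllis_locallyUnique_vacuumDevelopment`) and the boundary data `hbd` at a spacelike
boundary point of every common development with corresponding boundary points (the content of
Sbierski 2016, §3.2, Lemmas 14–16 and the level set of `τ_q` in the proof of Thm. 12). That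
content is now a THEOREM of the tree:
`CauchyDevelopment.CommonDevelopment.exists_boundaryData_of_hasCorrespondingBoundaryPoints`
(`Literature/Geometry/Lorentzian/CommonDevelopmentBoundaryData.lean`, over
`CorrespondingBoundaryData`, `CorrespondingBoundaryExtension` (Lemma 14),
`SpacelikeCorrespondingBoundaryPoint` (Lemma 15), `SpacelikeBoundaryFuturePoint` (Lemma 16),
`SpacelikeBoundaryLevelSet` / `TimeSeparationLevelFunction` (the level set),
`CorrespondingBoundaryTendsto` (Prop. 13)). Hence:

* `SubdataDevelopmentsEmbed.hbd_holds` — the hypothesis `hbd` of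
  `thm12_of_locallyUnique_of_boundaryData`, verbatim;
* `SubdataDevelopmentsEmbed.thm12_of_locallyUnique` — **Sbierski's Theorem 12 from LU alone**:
  `hawkingEllis_locallyUnique_vacuumDevelopment →
   sbierski_commonDevelopment_lt_of_hasCorrespondingBoundaryPoints`;
* `subdataDevelopmentsEmbed_of_locallyUnique` — **the item from LU alone**:
  `hawkingEllis_locallyUnique_vacuumDevelopment → SubdataDevelopmentsEmbed`.

CONDITIONAL on the single named fact LU (Hawking–Ellis 1973, §7.5; its PDE proof is reduced in
`Literature/Geometry/Lorentzian/CauchyProblemLocalUniquenessReduced.lean`). Closing line once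
`hawkingEllis_locallyUnique_vacuumDevelopment_holds` exists:
`subdataDevelopmentsEmbed_of_locallyUnique hawkingEllis_locallyUnique_vacuumDevelopment_holds`.
Pure composition; no definition; no new named fact.
-/

noncomputable section

open Function Set Filter Topology TopologicalSpace
open scoped Manifold ContDiff Topology

namespace Summit.FinalStateConjecture.FinalStateConjecture.Theorems

open Literature.Geometry.Lorentzian

namespace SubdataDevelopmentsEmbed

/-- **The boundary data `hbd` (Sbierski 2016, §3.2, Lemmas 14–16 and the level set of `τ_q`)
hold for every common globally hyperbolic development of two vacuum Cauchy developments with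
corresponding boundary points** — the hypothesis `hbd` of `thm12_of_locallyUnique_of_boundaryData`,
by `CauchyDevelopment.CommonDevelopment.exists_boundaryData_of_hasCorrespondingBoundaryPoints`.
[cite: Sbierski2016AHP, §3.2, Prop. 13, Lemmas 14–16 and proof of Thm. 12 (arXiv numbering)] -/
theorem hbd_holds :
    ∀ (N : Type) [TopologicalSpace N] [ChartedSpace E3 N] [IsManifold (𝓡 3) ∞ N]
      [ConnectedSpace N] (D₁ : InitialDataSet (𝓡 3) N) (𝒟₁ 𝒟₂ : VacuumCauchyDevelopment D₁)
      (𝔠 : CauchyDevelopment.CommonDevelopment 𝒟₁.toCauchyDevelopment 𝒟₂.toCauchyDevelopment),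
      𝔠.HasCorrespondingBoundaryPoints →
        ∃ (p₀ : 𝒟₁.carrier) (W : Set 𝒟₁.carrier) (f : 𝒟₁.carrier → ℝ)
          (ψ : 𝒟₁.carrier → 𝒟₂.carrier),
          p₀ ∉ 𝔠.opens ∧
          (p₀ ∈ 𝒟₁.metric.chronologicalFuture 𝒟₁.timeOrientation (range 𝒟₁.embed) ∨
            p₀ ∈ 𝒟₁.metric.chronologicalPast 𝒟₁.timeOrientation (range 𝒟₁.embed)) ∧
          IsOpen W ∧ p₀ ∈ W ∧ ContMDiffOn (𝓡 4) 𝓘(ℝ, ℝ) ∞ f W ∧ f p₀ = 0 ∧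
          (∀ v : TangentSpace (𝓡 4) p₀, 𝒟₁.timeOrientation.IsFutureDirected v →
            (0 : ℝ) < mfderiv (𝓡 4) 𝓘(ℝ, ℝ) f p₀ v) ∧
          (∀ q ∈ W, f q = 0 → q ∈ closure (𝔠.opens : Set 𝒟₁.carrier)) ∧
          ContMDiffOn (𝓡 4) (𝓡 4) ∞ ψ W ∧
          (∀ (q : 𝒟₁.carrier) (hq : q ∈ 𝔠.opens), q ∈ W → ψ q = 𝔠.map ⟨q, hq⟩) ∧
          Injective (mfderiv (𝓡 4) (𝓡 4) ψ p₀) :=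
  fun _ _ _ _ _ _ _ _ 𝔠 h ↦ 𝔠.exists_boundaryData_of_hasCorrespondingBoundaryPoints h

/-- **Sbierski's Theorem 12 from local geometric uniqueness alone**: a common globally hyperbolic
development of two vacuum developments of the same data with corresponding boundary points is
strictly contained in a larger one — `thm12_of_locallyUnique_of_boundaryData` with `hbd_holds`.
CONDITIONAL on LU (`hawkingEllis_locallyUnique_vacuumDevelopment`).
[cite: Sbierski2016AHP, §3.2, Thm. 12 (arXiv numbering)] [cite: HawkingEllis1973CUP, §7.5, pp. 248–249] -/
theorem thm12_of_locallyUnique (hLU : hawkingEllis_locallyUnique_vacuumDevelopment) :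
    sbierski_commonDevelopment_lt_of_hasCorrespondingBoundaryPoints :=
  thm12_of_locallyUnique_of_boundaryData hLU hbd_holds

end SubdataDevelopmentsEmbed

/-- **`SubdataDevelopmentsEmbed` from local geometric uniqueness alone**: the item follows from the
single named fact `hawkingEllis_locallyUnique_vacuumDevelopment` (Hawking–Ellis 1973, §7.5;
Sbierski 2016, Thm. 2.4 (ii)) — `subdataDevelopmentsEmbed_of_locallyUnique_of_boundaryData` with
the boundary data discharged (`SubdataDevelopmentsEmbed.hbd_holds`). CONDITIONAL on LU only.
[cite: Sbierski2016AHP, Thm. 2.4 (ii), §3.2 Thm. 12] [cite: HawkingEllis1973CUP, §7.5–7.6, pp. 248–251] -/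
theorem subdataDevelopmentsEmbed_of_locallyUnique (hLU : hawkingEllis_locallyUnique_vacuumDevelopment) :
    Summit.FinalStateConjecture.FinalStateConjecture.Theses.SwallowTheDatum.SubdataDevelopmentsEmbed :=
  SubdataDevelopmentsEmbed.subdataDevelopmentsEmbed_of_locallyUnique_of_boundaryData hLU
    SubdataDevelopmentsEmbed.hbd_holds

end Summit.FinalStateConjecture.FinalStateConjecture.Theorems

end
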